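import Summits.QuantumFields.YangMills.Theorems.UnitScaleTiltProp7H46RealityTrace
import Summits.QuantumFields.YangMills.Theorems.UnitScaleTiltProp7WilsonHessianSectorRows
import Summits.QuantumFields.YangMills.Theorems.UnitScaleTiltProp7SectET3WilsonHessianT3SigmaRows
import Summits.QuantumFields.YangMills.Theorems.UnitScaleTiltProp7QTwSRealityOfRegPr
import HarnessLib

/-!
# Route `UnitScaleTilt`, crux K1 child «MinimiserStabilityRegPr» (stmt-QuantumFields-19200), skeleton v10, stub `stub_existenceMinimalOrbit` (EX),
# route (α) — **THE `hH₁R` CLAUSE: PRINT'S `H`-TYPE LETTER AT AN ARBITRARY HESSIAN SLOT `Δx` (`Hf`, `H₁f`) MAPS HERMITIAN TRACELESS BLOCK DATA TO HERMITIAN TRACELESS FIELDS**,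
# given the slot's two rows (σ-commutation, traceless sector + symmetry); unconditional at the slot of `Δ^η` (`DeltaEtaSlot`) for `U₀ ∈ 𝔘_k(ε₀)` in the two windows

Cell `ym3-torus`, width seat `ym-ust-20520-w4` (gen 4).  THEOREMS ONLY (0 `def`, 0 `sorry`).  The generic-slot twin of ✓`Prop7H46RealityTrace.trace_H46_eq_zero_of_traceless` (there: the slot of
record `Δ_π` through `H46_comm`; here: any slot `Δx` through ✓`Prop7SectET3PropagatorsReality.Hf_comm`), so that the knit's `hH₁R` row — about the letter `H₁f … Δx U₀` read through
`JetSup.equiv` — is a theorem modulo the two data rows of ITS slot (for `Δ₁` of [Balaban1985Variational] (110): p01's `DeltaOne` letters).  Nothing here closes the stub;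
`--supports stmt-QuantumFields-19200 --as helper`, count-neutral.  YM₃ on T³ is a ladder rung (R3), not the Clay problem; nothing here claims the stub, the crux, d = 4 or the gap.

THE PRINT.  [Balaban1985Variational] (103) p. 293 `H₁ = G₁Q*(QG₁Q*)⁻¹`, (51) p. 286; [Balaban1985BackgroundPropagators] (3.126)∕(3.129) pp. 420–421, p. 393 «The operators … are real».

WHAT IS PROVED (sorry-free, no definition).  ★★`trace_Hf_eq_zero_of_traceless (Δx) (U₀) (hQtr) (hQsc) (hΔtr) (hΔsymm)` (reflections of the traceless sectors, unitary case of `Hf_comm`);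
★★`trace_H1f_eq_zero_of_traceless` (the `JetSup` reading); ★★★`H1f_isHermitian_traceless (Δx) (U₀) (hQ) (hΔx) (hQtr) (hQsc) (hΔtr) (hΔsymm)` = the knit's `hH₁R` clause SHAPE at any slot;
★★★`H1f_isHermitian_traceless_at_regPr (Δx) (hΔx) (hΔtr) (hΔsymm)` (the `QTwS` rows BY NAME from ★w5's ✓`Prop7QTwSRealityOfRegPr`); ★★★`H1f_isHermitian_traceless_at_regPr_DeltaEtaSlot` —
UNCONDITIONAL at the slot `Δ^η` (p01 ✓`DeltaEta_toL2_star`, ✓`DeltaEta_isSymmetric`, ✓`Prop7WilsonHessianSectorRows.trace_DeltaEta_toL2_eq_zero`).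

References: T. Bałaban, CMP 102 (1985) 277–309 [Balaban1985Variational] ((103) p.293, (51) p.286); CMP 99 (1985) 389–434 [Balaban1985BackgroundPropagators] ((3.126)–(3.129) pp.420–421, p.393).
-/

set_option autoImplicit false

noncomputable section

open scoped InnerProductSpace ComplexConjugate Matrix.Norms.L2Operator BigOperators

namespace Summit.QuantumFields.YangMills.Theorems.Prop7HfRealityTrace

open Literature.MathematicalPhysics.QuantumFieldTheory.Balaban1983to89
open Literature.MathematicalPhysics.QuantumFieldTheory.Balaban1983to89.T3ContinuumYM3Torus
open T3SectALandauChart (eta eta_pos)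
open T3PrintedRegularMinimiser (RegPr)
open B9SectCLatticeCarrier (Bond)
open B9Eq311L2Pairing (WL2)
open B11Eq103H1Complex (SiteL2K BondL2K)
open B11Eq115Space (JetSup)
open Summit.QuantumFields.YangMills.Theorems.Prop7SectET3Transport (periodsT3 siteEquiv bondEquiv bgOfCfg)
open Summit.QuantumFields.YangMills.Theorems.Prop7SectET3HilbertLetters (W₂ frobEquiv toL2 toL2S toL2B QL2 DL2 DstarL2 QL2_toL2 inner_toL2 inner_toL2B adjoint_DL2 toL2_symm_apply)
open Summit.QuantumFields.YangMills.Theorems.Prop7SectET3CurvedPropagators (HT Hf H1f Hf_apply H1f_apply)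
open Summit.QuantumFields.YangMills.Theorems.Prop7SectET3WilsonHessian (DeltaEta DeltaEtaSlot DeltaEta_isSymmetric DeltaEta_toL2_star)
open Summit.QuantumFields.YangMills.Theorems.Prop7SymAvgTwSym (QTwS QTwS_star_comm_of_regPr QTwS_scalar_of_regPr QTwS_traceless_of_regPr)
open Summit.QuantumFields.YangMills.Theorems.Prop7SectET3PropagatorsReality (Hf_comm)
open Summit.QuantumFields.YangMills.Theorems.Prop7SectET3HilbertLettersReality (trace_DL2_apply_eq_zero)
open Summit.QuantumFields.YangMills.Theorems.Prop7H46Reality (H1f_star_comm)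
open Summit.QuantumFields.YangMills.Theorems.Prop7H46RealityTrace (reflection_comm_of_mapsTo mapsTo_orthogonal_of_adjoint exists_smul_one_of_trace_orthogonal trace_conjTranspose_mul_smul_one
  trace_DstarL2_apply_eq_zero)
open Summit.QuantumFields.YangMills.Theorems.Prop7WilsonHessianSectorRows (trace_DeltaEta_toL2_eq_zero)

variable (F : T3Family) (n K : ℕ) (h : n ≤ K) (c₀ cB a : ℝ) [Fact (0 < c₀)] [Fact (0 < cB)]

/-- ★★ **AN `H`-LETTER AT ANY SYMMETRIC SLOT MAPS TRACELESS BLOCK DATA TO TRACELESS FIELDS** (`Hf … Δx U₀`, route carriers): reflections of the traceless sectors intertwined by the data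
`D_{U₀}`, `Q(U₀)` (rows `hQtr`∕`hQsc`) and the slot `Δx U₀` (traceless row `hΔtr` + symmetry `hΔsymm`), the UNITARY case of ✓`Hf_comm`.
[cite: Balaban1985Variational, (103) p.293, (51) p.286; Balaban1985BackgroundPropagators, (3.126)–(3.129) pp.420–421] -/
theorem trace_Hf_eq_zero_of_traceless (Δx : GaugeField (F.P K) 0 (Matrix.specialUnitaryGroup (Fin 2) ℂ) → (BondL2K ℂ 3 (periodsT3 F K) c₀ W₂ →ₗ[ℂ] BondL2K ℂ 3 (periodsT3 F K) c₀ W₂))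
    (U₀ : GaugeField (F.P K) 0 (Matrix.specialUnitaryGroup (Fin 2) ℂ))
    (hQtr : ∀ A : PBond (F.P K) 0 → Matrix (Fin 2) (Fin 2) ℂ, (∀ b, (A b).trace = 0) → ∀ c, (QTwS F n K h U₀ A c).trace = 0)
    (hQsc : ∀ c : PBond (F.P K) 0 → ℂ, ∃ d : PBond (F.P n) 0 → ℂ, QTwS F n K h U₀ (fun b => c b • (1 : Matrix (Fin 2) (Fin 2) ℂ)) = fun c' => d c' • 1)
    (hΔtr : ∀ A : PBond (F.P K) 0 → Matrix (Fin 2) (Fin 2) ℂ, (∀ b, (A b).trace = 0) → ∀ b, ((toL2 F K c₀).symm (Δx U₀ (toL2 F K c₀ A)) b).trace = 0)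
    (hΔsymm : (Δx U₀).IsSymmetric)
    (Y : PBond (F.P n) 0 → Matrix (Fin 2) (Fin 2) ℂ) (hY : ∀ c, (Y c).trace = 0) (b : PBond (F.P K) 0) :
    (Hf F n K h c₀ cB a Δx U₀ Y b).trace = 0 := by
  -- the traceless sectors of the three carriers
  let VE : Submodule ℂ (BondL2K ℂ 3 (periodsT3 F K) c₀ W₂) :=
    { carrier := {f | ∀ b, ((toL2 F K c₀).symm f b).trace = 0}
      add_mem' := fun {f g} hf hg b => by rw [map_add, Pi.add_apply, Matrix.trace_add, hf b, hg b, add_zero]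
      zero_mem' := fun b => by rw [map_zero, Pi.zero_apply, Matrix.trace_zero]
      smul_mem' := fun r f hf b => by rw [map_smul, Pi.smul_apply, Matrix.trace_smul, hf b, smul_zero] }
  let VS : Submodule ℂ (SiteL2K ℂ 3 (periodsT3 F K) c₀ W₂) :=
    { carrier := {g | ∀ x, ((toL2S F K c₀).symm g x).trace = 0}
      add_mem' := fun {f g} hf hg x => by rw [map_add, Pi.add_apply, Matrix.trace_add, hf x, hg x, add_zero]
      zero_mem' := fun x => by rw [map_zero, Pi.zero_apply, Matrix.trace_zero]
      smul_mem' := fun r f hf x => by rw [map_smul, Pi.smul_apply, Matrix.trace_smul, hf x, smul_zero] }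
  let VF : Submodule ℂ (WL2 ℂ (fun _ : PBond (F.P n) 0 => cB) W₂) :=
    { carrier := {y | ∀ c, ((toL2B F n cB).symm y c).trace = 0}
      add_mem' := fun {f g} hf hg c => by rw [map_add, Pi.add_apply, Matrix.trace_add, hf c, hg c, add_zero]
      zero_mem' := fun c => by rw [map_zero, Pi.zero_apply, Matrix.trace_zero]
      smul_mem' := fun r f hf c => by rw [map_smul, Pi.smul_apply, Matrix.trace_smul, hf c, smul_zero] }
  haveI : CompleteSpace VE := FiniteDimensional.complete ℂ VE
  haveI : CompleteSpace VS := FiniteDimensional.complete ℂ VS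
  haveI : CompleteSpace VF := FiniteDimensional.complete ℂ VF
  -- membership through the route-carrier readings
  have memVE : ∀ A : PBond (F.P K) 0 → Matrix (Fin 2) (Fin 2) ℂ, toL2 F K c₀ A ∈ VE ↔ ∀ b, (A b).trace = 0 := fun A => by
    change (∀ b, ((toL2 F K c₀).symm (toL2 F K c₀ A) b).trace = 0) ↔ _
    rw [LinearEquiv.symm_apply_apply]
  have memVF : ∀ B : PBond (F.P n) 0 → Matrix (Fin 2) (Fin 2) ℂ, toL2B F n cB B ∈ VF ↔ ∀ c, (B c).trace = 0 := fun B => by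
    change (∀ c, ((toL2B F n cB).symm (toL2B F n cB B) c).trace = 0) ↔ _
    rw [LinearEquiv.symm_apply_apply]
  -- the complements: scalar-valued fields (both directions on `E`, one on `F`)
  have scalar_mem_VEc : ∀ c : PBond (F.P K) 0 → ℂ, toL2 F K c₀ (fun b => c b • (1 : Matrix (Fin 2) (Fin 2) ℂ)) ∈ VEᗮ := by
    intro c
    rw [Submodule.mem_orthogonal]
    intro v hv
    obtain ⟨A, rfl⟩ : ∃ A, v = toL2 F K c₀ A := ⟨(toL2 F K c₀).symm v, ((toL2 F K c₀).apply_symm_apply v).symm⟩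
    rw [inner_toL2]
    refine mul_eq_zero_of_right _ (Finset.sum_eq_zero fun b _ => trace_conjTranspose_mul_smul_one ((memVE A).1 hv b) (c b))
  have scalar_mem_VFc : ∀ d : PBond (F.P n) 0 → ℂ, toL2B F n cB (fun c => d c • (1 : Matrix (Fin 2) (Fin 2) ℂ)) ∈ VFᗮ := by
    intro d
    rw [Submodule.mem_orthogonal]
    intro v hv
    obtain ⟨B, rfl⟩ : ∃ B, v = toL2B F n cB B := ⟨(toL2B F n cB).symm v, ((toL2B F n cB).apply_symm_apply v).symm⟩
    rw [inner_toL2B]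
    refine mul_eq_zero_of_right _ (Finset.sum_eq_zero fun c _ => trace_conjTranspose_mul_smul_one ((memVF B).1 hv c) (d c))
  have exists_scalar_of_mem_VEc : ∀ u ∈ VEᗮ, ∃ c : PBond (F.P K) 0 → ℂ, u = toL2 F K c₀ (fun b => c b • (1 : Matrix (Fin 2) (Fin 2) ℂ)) := by
    intro u hu
    obtain ⟨A, rfl⟩ : ∃ A, u = toL2 F K c₀ A := ⟨(toL2 F K c₀).symm u, ((toL2 F K c₀).apply_symm_apply u).symm⟩
    have hpt : ∀ b, ∃ c : ℂ, A b = c • (1 : Matrix (Fin 2) (Fin 2) ℂ) := by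
      intro b
      refine exists_smul_one_of_trace_orthogonal (A b) fun X hX => ?_
      have hmem : toL2 F K c₀ (Pi.single b X) ∈ VE := (memVE _).2 fun b' => by
        by_cases hb : b' = b
        · subst hb; rw [Pi.single_eq_same]; exact hX
        · rw [Pi.single_eq_of_ne hb, Matrix.trace_zero]
      have h0 := (Submodule.mem_orthogonal _ _).1 hu _ hmem
      rw [inner_toL2, Finset.sum_eq_single b (fun b' _ hb' => by rw [Pi.single_eq_of_ne hb', Matrix.conjTranspose_zero, Matrix.zero_mul, Matrix.trace_zero])
        (fun hb => (hb (Finset.mem_univ b)).elim), Pi.single_eq_same] at h0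
      have hc₀ : ((c₀ : ℝ) : ℂ) ≠ 0 := Complex.ofReal_ne_zero.2 (ne_of_gt (Fact.out : 0 < c₀))
      exact (mul_eq_zero.1 h0).resolve_left hc₀
    choose c hc using hpt
    exact ⟨c, congrArg _ (funext hc)⟩
  -- DATA ROWS in sector form
  have hD_V : ∀ g ∈ VS, DL2 F n K c₀ U₀ g ∈ VE := by
    intro g hg
    obtain ⟨l, rfl⟩ : ∃ l, g = toL2S F K c₀ l := ⟨(toL2S F K c₀).symm g, ((toL2S F K c₀).apply_symm_apply g).symm⟩
    have hl : ∀ x, (l x).trace = 0 := fun x => by have := hg x; rwa [LinearEquiv.symm_apply_apply] at this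
    exact fun b' => trace_DL2_apply_eq_zero U₀ l hl b'
  have hDstar_V : ∀ f ∈ VE, LinearMap.adjoint (DL2 F n K c₀ U₀) f ∈ VS := by
    intro f hf
    obtain ⟨A, rfl⟩ : ∃ A, f = toL2 F K c₀ A := ⟨(toL2 F K c₀).symm f, ((toL2 F K c₀).apply_symm_apply f).symm⟩
    rw [adjoint_DL2]
    exact fun x => trace_DstarL2_apply_eq_zero F n K c₀ U₀ A ((memVE A).1 hf) x
  have hD_Vc : ∀ u ∈ VSᗮ, DL2 F n K c₀ U₀ u ∈ VEᗮ := fun u hu => mapsTo_orthogonal_of_adjoint _ VS VE hDstar_V hu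
  have hQ_V : ∀ f ∈ VE, QL2 F n K h c₀ cB U₀ f ∈ VF := by
    intro f hf
    obtain ⟨A, rfl⟩ : ∃ A, f = toL2 F K c₀ A := ⟨(toL2 F K c₀).symm f, ((toL2 F K c₀).apply_symm_apply f).symm⟩
    rw [QL2_toL2]
    exact (memVF _).2 (hQtr A ((memVE A).1 hf))
  have hQ_Vc : ∀ u ∈ VEᗮ, QL2 F n K h c₀ cB U₀ u ∈ VFᗮ := by
    intro u hu
    obtain ⟨c, rfl⟩ := exists_scalar_of_mem_VEc u hu
    obtain ⟨d, hd⟩ := hQsc c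
    rw [QL2_toL2, hd]
    exact scalar_mem_VFc d
  have hΔ_V : ∀ f ∈ VE, (Δx U₀) f ∈ VE := by
    intro f hf
    obtain ⟨A, rfl⟩ : ∃ A, f = toL2 F K c₀ A := ⟨(toL2 F K c₀).symm f, ((toL2 F K c₀).apply_symm_apply f).symm⟩
    exact fun b' => hΔtr A ((memVE A).1 hf) b'
  -- the slot is symmetric, so it preserves the complement of every sector it preserves
  have hΔ_Vc : ∀ u ∈ VEᗮ, (Δx U₀) u ∈ VEᗮ := fun u hu =>
    mapsTo_orthogonal_of_adjoint _ VE VE (fun v hv => by rw [hΔsymm.adjoint_eq]; exact hΔ_V v hv) hu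
  -- the reflections intertwined by the data
  have hD : ∀ s, DL2 F n K c₀ U₀ (VS.reflection s) = VE.reflection (DL2 F n K c₀ U₀ s) := reflection_comm_of_mapsTo VS VE _ hD_V hD_Vc
  have hQ : ∀ x, QL2 F n K h c₀ cB U₀ (VE.reflection x) = VF.reflection (QL2 F n K h c₀ cB U₀ x) := reflection_comm_of_mapsTo VE VF _ hQ_V hQ_Vc
  have hΔη : ∀ x, Δx U₀ (VE.reflection x) = VE.reflection (Δx U₀ x) := reflection_comm_of_mapsTo VE VE _ hΔ_V hΔ_Vc
  -- part 1 at the unitary (reflection) triple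
  have key := Hf_comm F n K h c₀ cB a U₀ (fun x => VE.reflection x) (fun s => VS.reflection s) (fun y => VF.reflection y) Δx
    (Or.inr ⟨fun x y => VE.reflection.inner_map_map x y, fun x y => VS.reflection.inner_map_map x y, fun x y => VF.reflection.inner_map_map x y⟩)
    (fun x y => map_add _ x y) (fun x y => map_add _ x y) (fun x y => map_add _ x y)
    (fun x => VE.reflection_reflection x) (fun s => VS.reflection_reflection s) (fun y => VF.reflection_reflection y)
    (fun r x => map_smul _ _ x) (fun r y => map_smul _ _ y) hD hQ hΔη Y
  -- traceless data are fixed by `ρ_{V_F}`; hence `toL2 (H Y)` is fixed by `ρ_{V_E}`, i.e. traceless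
  have hYmem : toL2B F n cB Y ∈ VF := (memVF Y).2 hY
  rw [Submodule.reflection_mem_subspace_eq_self hYmem, LinearEquiv.symm_apply_apply] at key
  have hfix : VE.reflection (toL2 F K c₀ (Hf F n K h c₀ cB a Δx U₀ Y)) = toL2 F K c₀ (Hf F n K h c₀ cB a Δx U₀ Y) := by
    have := congrArg (toL2 F K c₀) key
    rw [LinearEquiv.apply_symm_apply] at this
    exact this.symm
  exact (memVE _).1 ((Submodule.reflection_eq_self_iff _).1 hfix) b


/-- ★★ **THE `JetSup` READING: `H₁f … Δx U₀ B` IS TRACELESS-VALUED FOR TRACELESS `B`** (`(H₁f B)(x) = η⁻¹·(Hf B)(bondEquiv⁻¹ x)` up to `frobEquiv`: ✓`H1f_apply`, ✓`Hf_apply`, ✓`toL2_symm_apply`).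
[cite: Balaban1985Variational, (103) p.293, (51) p.286] -/
theorem trace_H1f_eq_zero_of_traceless [Fact (0 < (F.L : ℝ))] [Fact (0 < ((F.L : ℝ)⁻¹) ^ (K - n))]
    (Δx : GaugeField (F.P K) 0 (Matrix.specialUnitaryGroup (Fin 2) ℂ) → (BondL2K ℂ 3 (periodsT3 F K) c₀ W₂ →ₗ[ℂ] BondL2K ℂ 3 (periodsT3 F K) c₀ W₂))
    (U₀ : GaugeField (F.P K) 0 (Matrix.specialUnitaryGroup (Fin 2) ℂ))
    (hQtr : ∀ A : PBond (F.P K) 0 → Matrix (Fin 2) (Fin 2) ℂ, (∀ b, (A b).trace = 0) → ∀ c, (QTwS F n K h U₀ A c).trace = 0)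
    (hQsc : ∀ c : PBond (F.P K) 0 → ℂ, ∃ d : PBond (F.P n) 0 → ℂ, QTwS F n K h U₀ (fun b => c b • (1 : Matrix (Fin 2) (Fin 2) ℂ)) = fun c' => d c' • 1)
    (hΔtr : ∀ A : PBond (F.P K) 0 → Matrix (Fin 2) (Fin 2) ℂ, (∀ b, (A b).trace = 0) → ∀ b, ((toL2 F K c₀).symm (Δx U₀ (toL2 F K c₀ A)) b).trace = 0)
    (hΔsymm : (Δx U₀).IsSymmetric)
    (B : PBond (F.P n) 0 → Matrix (Fin 2) (Fin 2) ℂ) (hB : ∀ c, (B c).trace = 0) (x : Bond 3 (periodsT3 F K)) :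
    (JetSup.equiv _ _ _ (H1f F n K h c₀ cB a Δx U₀ B) x).trace = 0 := by
  have hη : ((eta F n K : ℝ) : ℂ) ≠ 0 := Complex.ofReal_ne_zero.2 (ne_of_gt (eta_pos F n K))
  have hb := trace_Hf_eq_zero_of_traceless F n K h c₀ cB a Δx U₀ hQtr hQsc hΔtr hΔsymm B hB ((bondEquiv F K).symm x)
  rw [Hf_apply, Pi.smul_apply, Matrix.trace_smul, smul_eq_zero, toL2_symm_apply, Equiv.apply_symm_apply] at hb
  rw [H1f_apply]
  exact hb.resolve_left hη

/-- ★★★ **THE KNIT'S `hH₁R` CLAUSE SHAPE AT ANY SLOT**: Hermitian traceless block data `B` give Hermitian traceless `(H₁f … Δx U₀ B)(x)`, given the `QTwS` star-row `hQ` + sectors `hQtr`∕`hQsc`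
and the slot's σ-row `hΔx`, traceless row `hΔtr` and symmetry `hΔsymm` (star half ✓`Prop7H46Reality.H1f_star_comm`). [cite: Balaban1985Variational, (103) p.293, (51) p.286] -/
theorem H1f_isHermitian_traceless [Fact (0 < (F.L : ℝ))] [Fact (0 < ((F.L : ℝ)⁻¹) ^ (K - n))]
    (Δx : GaugeField (F.P K) 0 (Matrix.specialUnitaryGroup (Fin 2) ℂ) → (BondL2K ℂ 3 (periodsT3 F K) c₀ W₂ →ₗ[ℂ] BondL2K ℂ 3 (periodsT3 F K) c₀ W₂))
    (U₀ : GaugeField (F.P K) 0 (Matrix.specialUnitaryGroup (Fin 2) ℂ))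
    (hQ : ∀ A : PBond (F.P K) 0 → Matrix (Fin 2) (Fin 2) ℂ, QTwS F n K h U₀ (star A) = star (QTwS F n K h U₀ A))
    (hΔx : ∀ f : BondL2K ℂ 3 (periodsT3 F K) c₀ W₂, Δx U₀ (toL2 F K c₀ (star ((toL2 F K c₀).symm f))) = toL2 F K c₀ (star ((toL2 F K c₀).symm (Δx U₀ f))))
    (hQtr : ∀ A : PBond (F.P K) 0 → Matrix (Fin 2) (Fin 2) ℂ, (∀ b, (A b).trace = 0) → ∀ c, (QTwS F n K h U₀ A c).trace = 0)
    (hQsc : ∀ c : PBond (F.P K) 0 → ℂ, ∃ d : PBond (F.P n) 0 → ℂ, QTwS F n K h U₀ (fun b => c b • (1 : Matrix (Fin 2) (Fin 2) ℂ)) = fun c' => d c' • 1)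
    (hΔtr : ∀ A : PBond (F.P K) 0 → Matrix (Fin 2) (Fin 2) ℂ, (∀ b, (A b).trace = 0) → ∀ b, ((toL2 F K c₀).symm (Δx U₀ (toL2 F K c₀ A)) b).trace = 0)
    (hΔsymm : (Δx U₀).IsSymmetric) :
    ∀ B : PBond (F.P n) 0 → Matrix (Fin 2) (Fin 2) ℂ, (∀ c, (B c).IsHermitian ∧ (B c).trace = 0) →
      ∀ x : Bond 3 (periodsT3 F K), (JetSup.equiv _ _ _ (H1f F n K h c₀ cB a Δx U₀ B) x).IsHermitian ∧ (JetSup.equiv _ _ _ (H1f F n K h c₀ cB a Δx U₀ B) x).trace = 0 :=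
  fun B hB x =>
    ⟨by
      have hB' : star B = B := funext fun c => by rw [Pi.star_apply, Matrix.star_eq_conjTranspose, (hB c).1.eq]
      have key := H1f_star_comm F n K h c₀ cB a Δx U₀ hQ hΔx B x
      rw [hB'] at key
      rw [Matrix.IsHermitian, ← Matrix.star_eq_conjTranspose]
      exact key.symm,
    trace_H1f_eq_zero_of_traceless F n K h c₀ cB a Δx U₀ hQtr hQsc hΔtr hΔsymm B (fun c => (hB c).2) x⟩

/-- ★★★ **`hH₁R` AT ANY SLOT, `U₀ ∈ 𝔘_k(ε₀)` IN THE WINDOWS — the `QTwS` rows BY NAME** (★w5 ✓`QTwS_star_comm_of_regPr`∕`QTwS_traceless_of_regPr`∕`QTwS_scalar_of_regPr`): only the slot's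
three rows remain displayed. [cite: Balaban1985Variational, (103) p.293, (51) p.286] -/
theorem H1f_isHermitian_traceless_at_regPr [Fact (0 < (F.L : ℝ))] [Fact (0 < ((F.L : ℝ)⁻¹) ^ (K - n))]
    (Δx : GaugeField (F.P K) 0 (Matrix.specialUnitaryGroup (Fin 2) ℂ) → (BondL2K ℂ 3 (periodsT3 F K) c₀ W₂ →ₗ[ℂ] BondL2K ℂ 3 (periodsT3 F K) c₀ W₂))
    {ε₀ e : ℝ} (hε₀ : 0 < ε₀) (he : 0 < e) (hWe : 10 ^ 9 * (F.L : ℝ) ^ 2 * e ≤ 1) (hWε : 10 ^ 12 * (F.L : ℝ) ^ 3 * ε₀ ≤ 1)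
    (U₀ : GaugeField (F.P K) 0 (Matrix.specialUnitaryGroup (Fin 2) ℂ)) (hreg : RegPr F n K ε₀ U₀)
    (hΔx : ∀ f : BondL2K ℂ 3 (periodsT3 F K) c₀ W₂, Δx U₀ (toL2 F K c₀ (star ((toL2 F K c₀).symm f))) = toL2 F K c₀ (star ((toL2 F K c₀).symm (Δx U₀ f))))
    (hΔtr : ∀ A : PBond (F.P K) 0 → Matrix (Fin 2) (Fin 2) ℂ, (∀ b, (A b).trace = 0) → ∀ b, ((toL2 F K c₀).symm (Δx U₀ (toL2 F K c₀ A)) b).trace = 0)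
    (hΔsymm : (Δx U₀).IsSymmetric) :
    ∀ B : PBond (F.P n) 0 → Matrix (Fin 2) (Fin 2) ℂ, (∀ c, (B c).IsHermitian ∧ (B c).trace = 0) →
      ∀ x : Bond 3 (periodsT3 F K), (JetSup.equiv _ _ _ (H1f F n K h c₀ cB a Δx U₀ B) x).IsHermitian ∧ (JetSup.equiv _ _ _ (H1f F n K h c₀ cB a Δx U₀ B) x).trace = 0 :=
  H1f_isHermitian_traceless F n K h c₀ cB a Δx U₀ (QTwS_star_comm_of_regPr F h hε₀ he hWe hWε U₀ hreg) hΔx (QTwS_traceless_of_regPr F h hε₀ he hWe hWε U₀ hreg)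
    (QTwS_scalar_of_regPr F h hε₀ hWε U₀ hreg) hΔtr hΔsymm

/-- ★★★ **`hH₁R` AT THE SLOT `Δ^η` (`DeltaEtaSlot`) — UNCONDITIONAL** at `U₀ ∈ 𝔘_k(ε₀)` in the windows: the slot rows are p01's ✓`DeltaEta_toL2_star`, ✓`DeltaEta_isSymmetric` and
✓`Prop7WilsonHessianSectorRows.trace_DeltaEta_toL2_eq_zero`. [cite: Balaban1985Variational, (103) p.293, (51) p.286; Balaban1985BackgroundPropagators, (3.12) p.392] -/
theorem H1f_isHermitian_traceless_at_regPr_DeltaEtaSlot [Fact (0 < (F.L : ℝ))] [Fact (0 < ((F.L : ℝ)⁻¹) ^ (K - n))]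
    {ε₀ e : ℝ} (hε₀ : 0 < ε₀) (he : 0 < e) (hWe : 10 ^ 9 * (F.L : ℝ) ^ 2 * e ≤ 1) (hWε : 10 ^ 12 * (F.L : ℝ) ^ 3 * ε₀ ≤ 1)
    (U₀ : GaugeField (F.P K) 0 (Matrix.specialUnitaryGroup (Fin 2) ℂ)) (hreg : RegPr F n K ε₀ U₀) :
    ∀ B : PBond (F.P n) 0 → Matrix (Fin 2) (Fin 2) ℂ, (∀ c, (B c).IsHermitian ∧ (B c).trace = 0) →
      ∀ x : Bond 3 (periodsT3 F K), (JetSup.equiv _ _ _ (H1f F n K h c₀ cB a (DeltaEtaSlot F n K c₀) U₀ B) x).IsHermitian ∧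
        (JetSup.equiv _ _ _ (H1f F n K h c₀ cB a (DeltaEtaSlot F n K c₀) U₀ B) x).trace = 0 :=
  H1f_isHermitian_traceless_at_regPr F n K h c₀ cB a (DeltaEtaSlot F n K c₀) hε₀ he hWe hWε U₀ hreg
    (fun f => by have key := DeltaEta_toL2_star (F := F) (n := n) (K := K) (c₀ := c₀) U₀ ((toL2 F K c₀).symm f); rwa [LinearEquiv.apply_symm_apply] at key)
    (fun A hA b => trace_DeltaEta_toL2_eq_zero U₀ A hA b) (DeltaEta_isSymmetric U₀)

end Summit.QuantumFields.YangMills.Theorems.Prop7HfRealityTrace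

end
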